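import Literature.Analysis.FluidPDE.AcceleratingDissipationEnhancement
import Literature.Analysis.FluidPDE.PassiveScalarForced
import HarnessLib

/-!
# Weak solutions of the forced passive scalar equation with constant diagonal diffusion,
# `∂ₜθ + u·∇θ = κ ∑ᵢ aᵢ ∂ᵢ∂ᵢθ + s` on `T^d × [0,T)`

Definition request D1 of cell `ad-ideate` (planner `ad-p1`, ROUND-10 §B: the sourced twin of
`Torus.IsWeakScalarTransportDiagOn`, needed to state a scalar zeroth law in the Hess-Childs–Rowan
rendering, where the isotropic `κΔ` of the flat torus `[0,√2]×[0,1]` becomes `κ(½∂₀∂₀ + ∂₁∂₁)` on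
the unit torus — see the module docstring of `AcceleratingDissipationEnhancement`).

* `Torus.IsWeakScalarTransportDiagForcedOn T a κ u s θ₀ θ` — the fields of
  `Torus.IsWeakScalarTransportDiagOn` verbatim, plus, verbatim from `Torus.IsWeakScalarTransportForcedOn`,
  measurability of the source, `s ∈ L¹((0,T) × T^d)`, and the source term `∫₀ᵀ∫ s ψ` in the weak
  identity: `∫₀ᵀ ∫ θ (∂ₜψ + u·∇ψ + κ ∑ᵢ aᵢ ∂ᵢ∂ᵢψ) + ∫₀ᵀ ∫ s ψ + ∫ θ₀ ψ(0) = 0`;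
* `Torus.IsWeakScalarTransportDiagForced a κ u s θ₀ θ` — on `[0,T)` for every `T > 0`;
* API: `isWeakScalarTransportDiagForcedOn_zero_iff` (`s = 0` ⇔ `IsWeakScalarTransportDiagOn`),
  `isWeakScalarTransportDiagForcedOn_one_iff` (`a ≡ 1` ⇔ `IsWeakScalarTransportForcedOn`),
  `isWeakScalarTransportDiagForcedOn_smul_iff` (`(c • a, κ)` ⇔ `(a, cκ)`), `IsWeakScalarTransportDiagForced.on`.

## Mathlib / tree search

Tree: `Torus.IsWeakScalarTransportDiagOn` (+ `_smul_iff`, `_one_iff`), `Torus.IsWeakScalarTransportForcedOn`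
(+ `_zero_iff`), `Torus.IsWeakScalarTransportOn`; `lean search IsWeakScalarTransportDiagForced`: nothing.

## References

* R. J. DiPerna, P.-L. Lions, Invent. Math. 98 (1989), §II.1 (12)–(14) (weak solutions of transport–diffusion). [DiPernaLions1989]
* T. D. Drivas, T. M. Elgindi, G. Iyer, I.-J. Jeong, *Anomalous dissipation in passive scalar transport*, ARMA 243 (2022), (1.1) (the forced equation). [DEIJ2022]
* E. Hess-Childs, K. Rowan, arXiv:2501.18526 (2025), Def. 2.2 (the torus `[0,√2]×[0,1]`). [HessChildsRowan2025a]
-/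

noncomputable section

namespace Literature.Analysis.FluidPDE

open _root_.MeasureTheory _root_.Set
open scoped NNReal ENNReal InnerProductSpace

namespace Torus

variable {d : Type*} [Fintype d] [DecidableEq d]

/-- Weak (distributional) solutions of the **forced** passive scalar equation with a constant
**diagonal** diffusion, `∂ₜθ + u·∇θ = κ ∑ᵢ aᵢ ∂ᵢ∂ᵢθ + s` on `T^d × [0,T)` with datum `θ₀`: the
conjuncts of `Torus.IsWeakScalarTransportDiagOn T a κ u θ₀ θ` verbatim (DiPerna–Lions 1989, §II.1,
(12)–(14) with `p = q = 2` plus viscosity: `θ ∈ L^∞_t L²_x`, `u ∈ L¹_t L²_x`, `u θ ∈ L¹_{t,x}`, `u(t)`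
weakly divergence free for a.e. `t`, smooth space–time tests `Torus.IsSpaceTimeTest T ψ` possibly
nonzero at `t = 0`, `κΔψ` replaced by `κ ∑ᵢ aᵢ ∂ᵢ∂ᵢψ`), plus — verbatim from
`Torus.IsWeakScalarTransportForcedOn` (DEIJ 2022, (1.1) with forcing) — `s` a.e. strongly measurable,
`s ∈ L¹((0,T) × T^d)`, and the source term in the weak formulation
`∫₀ᵀ ∫ θ (∂ₜψ + u·∇ψ + κ ∑ᵢ aᵢ ∂ᵢ∂ᵢψ) + ∫₀ᵀ ∫ s ψ + ∫ θ₀ ψ(0) = 0`. This is the form the forced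
isotropic equation `∂ₜθ + u·∇θ = κΔθ + s` on a rectangular flat torus `ℝ^d/⊕ᵢ Lᵢℤ` takes on the unit
torus in the coordinates `xᵢ = Lᵢ xᵢ'` (`aᵢ = Lᵢ⁻²`; Hess-Childs–Rowan: `L = (√2, 1)`, `a = (½, 1)`).
[cite: DiPernaLions1989, §II.1 (12)–(14); source term as in DEIJ2022, (1.1)] -/
@[mk_iff]
structure IsWeakScalarTransportDiagForcedOn (T : ℝ) (a : d → ℝ) (κ : ℝ)
    (u : ℝ → UnitAddTorus d → EuclideanSpace ℝ d) (s : ℝ → UnitAddTorus d → ℝ)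
    (θ₀ : UnitAddTorus d → ℝ) (θ : ℝ → UnitAddTorus d → ℝ) : Prop where
  /-- `θ` is a.e. strongly measurable on `(0,T) × T^d` (through the space–time lift). -/
  aestronglyMeasurable :
    AEStronglyMeasurable (FunctionSpaces.Torus.stLift θ) (volume.restrict (Ioo 0 T ×ˢ univ))
  /-- `u` is a.e. strongly measurable on `(0,T) × T^d` (through the space–time lift). -/
  aestronglyMeasurable_velocity :
    AEStronglyMeasurable (FunctionSpaces.Torus.stLift u) (volume.restrict (Ioo 0 T ×ˢ univ))
  /-- `s` is a.e. strongly measurable on `(0,T) × T^d` (through the space–time lift). -/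
  aestronglyMeasurable_source :
    AEStronglyMeasurable (FunctionSpaces.Torus.stLift s) (volume.restrict (Ioo 0 T ×ˢ univ))
  /-- `θ ∈ L^∞(0,T; L²(T^d))`: `∫ |θ(t)|² ≤ C` for a.e. `t ∈ (0,T)`. -/
  ae_lintegral_sq_le : ∃ C : ℝ≥0, ∀ᵐ t ∂(volume.restrict (Ioo 0 T)), ∫⁻ x, ‖θ t x‖ₑ ^ 2 ≤ C
  /-- `u ∈ L¹(0,T; L²(T^d))`. -/
  lintegral_velocity_lt_top :
    ∫⁻ t in Ioo 0 T, (∫⁻ x, ‖u t x‖ₑ ^ 2) ^ (1 / 2 : ℝ) < ∞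
  /-- `u θ ∈ L¹((0,T) × T^d)`. -/
  lintegral_mul_lt_top : ∫⁻ t in Ioo 0 T, ∫⁻ x, ‖u t x‖ₑ * ‖θ t x‖ₑ < ∞
  /-- `s ∈ L¹((0,T) × T^d)`. -/
  lintegral_source_lt_top : ∫⁻ t in Ioo 0 T, ∫⁻ x, ‖s t x‖ₑ < ∞
  /-- `div u(t) = 0` weakly, for a.e. `t ∈ (0,T)`. -/
  ae_isWeaklyDivFree :
    ∀ᵐ t ∂(volume.restrict (Ioo 0 T)), FunctionSpaces.Torus.IsWeaklyDivFree (u t)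
  /-- The weak formulation with datum and source:
  `∫₀ᵀ ∫ θ (∂ₜψ + u·∇ψ + κ ∑ᵢ aᵢ ∂ᵢ∂ᵢψ) + ∫₀ᵀ ∫ s ψ + ∫ θ₀ ψ(0) = 0`. -/
  weak_eq : ∀ ψ : ℝ → UnitAddTorus d → ℝ, FunctionSpaces.Torus.IsSpaceTimeTest T ψ →
    (∫ t in Ioo 0 T, ∫ x, θ t x *
        (FunctionSpaces.Torus.timeDeriv ψ t x +
            ⟪u t x, FunctionSpaces.Torus.gradient (ψ t) x⟫_ℝ +
          κ * ∑ i, a i * FunctionSpaces.Torus.partialDeriv i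
            (FunctionSpaces.Torus.partialDeriv i (ψ t)) x)) +
      (∫ t in Ioo 0 T, ∫ x, s t x * ψ t x) +
      ∫ x, θ₀ x * ψ 0 x = 0

/-- Global weak solutions of the forced diagonal-diffusion passive scalar equation on `T^d × [0, ∞)`:
weak solutions on `[0, T)` for every `T > 0`. [cite: DiPernaLions1989, §II.1 (12)–(14); source term as in DEIJ2022, (1.1)] -/
def IsWeakScalarTransportDiagForced (a : d → ℝ) (κ : ℝ)
    (u : ℝ → UnitAddTorus d → EuclideanSpace ℝ d) (s : ℝ → UnitAddTorus d → ℝ)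
    (θ₀ : UnitAddTorus d → ℝ) (θ : ℝ → UnitAddTorus d → ℝ) : Prop :=
  ∀ T : ℝ, 0 < T → IsWeakScalarTransportDiagForcedOn T a κ u s θ₀ θ

variable {T κ : ℝ} {a : d → ℝ} {u : ℝ → UnitAddTorus d → EuclideanSpace ℝ d}
  {s : ℝ → UnitAddTorus d → ℝ} {θ₀ : UnitAddTorus d → ℝ} {θ : ℝ → UnitAddTorus d → ℝ}

/-- **`s = 0` recovers the homogeneous diagonal notion**: the extra conjuncts hold trivially for
`s = 0` and the source term `∫∫ 0 · ψ` vanishes. [cite: DiPernaLions1989, §II.1 (12)–(14)] -/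
theorem isWeakScalarTransportDiagForcedOn_zero_iff :
    IsWeakScalarTransportDiagForcedOn T a κ u 0 θ₀ θ ↔ IsWeakScalarTransportDiagOn T a κ u θ₀ θ := by
  constructor
  · intro h
    refine ⟨h.aestronglyMeasurable, h.aestronglyMeasurable_velocity, h.ae_lintegral_sq_le,
      h.lintegral_velocity_lt_top, h.lintegral_mul_lt_top, h.ae_isWeaklyDivFree, fun ψ hψ => ?_⟩
    simpa using h.weak_eq ψ hψ
  · intro h
    refine ⟨h.aestronglyMeasurable, h.aestronglyMeasurable_velocity, ?_, h.ae_lintegral_sq_le,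
      h.lintegral_velocity_lt_top, h.lintegral_mul_lt_top, by simp, h.ae_isWeaklyDivFree,
      fun ψ hψ => ?_⟩
    · exact aestronglyMeasurable_const (b := (0 : ℝ))
    · simpa using h.weak_eq ψ hψ

/-- **Scaling the coefficients is scaling the diffusivity**: weak solutions for `(c • a, κ)` are
exactly the weak solutions for `(a, cκ)` (the weak formulations coincide term by term). In particular
diffusion `(½, 1)` at diffusivity `κ` is diffusion `(1, 2)` at diffusivity `κ/2`.
[cite: DiPernaLions1989, §II.1 (12)–(14)] -/
theorem isWeakScalarTransportDiagForcedOn_smul_iff (c : ℝ) :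
    IsWeakScalarTransportDiagForcedOn T (c • a) κ u s θ₀ θ ↔
      IsWeakScalarTransportDiagForcedOn T a (c * κ) u s θ₀ θ := by
  have key : ∀ (f : UnitAddTorus d → ℝ) (x : UnitAddTorus d),
      κ * ∑ i, (c • a) i * FunctionSpaces.Torus.partialDeriv i
          (FunctionSpaces.Torus.partialDeriv i f) x =
        c * κ * ∑ i, a i * FunctionSpaces.Torus.partialDeriv i
          (FunctionSpaces.Torus.partialDeriv i f) x := by
    intro f x
    simp only [Pi.smul_apply, smul_eq_mul, Finset.mul_sum]
    exact Finset.sum_congr rfl fun i _ => by ring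
  simp only [isWeakScalarTransportDiagForcedOn_iff, key]

/-- **With all coefficients `1` the notion is the isotropic forced one** (`Torus.IsWeakScalarTransportForcedOn`):
on the smooth time slices of a space–time test field `Δψ = ∑ᵢ ∂ᵢ∂ᵢψ`
(`Torus.laplacian_eq_sum_partialDeriv_partialDeriv`). [cite: DEIJ2022, (1.1)] -/
theorem isWeakScalarTransportDiagForcedOn_one_iff :
    IsWeakScalarTransportDiagForcedOn T (fun _ => 1) κ u s θ₀ θ ↔ IsWeakScalarTransportForcedOn T κ u s θ₀ θ := by
  have key : ∀ ψ : ℝ → UnitAddTorus d → ℝ, FunctionSpaces.Torus.IsSpaceTimeTest T ψ →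
      ∀ (t : ℝ) (x : UnitAddTorus d),
        κ * ∑ i, (fun _ : d => (1 : ℝ)) i * FunctionSpaces.Torus.partialDeriv i
            (FunctionSpaces.Torus.partialDeriv i (ψ t)) x =
          κ * FunctionSpaces.Torus.laplacian (ψ t) x := by
    intro ψ hψ t x
    rw [FunctionSpaces.Torus.laplacian_eq_sum_partialDeriv_partialDeriv (hψ.isSmooth_slice t)]
    simp only [one_mul]
  constructor
  · rintro ⟨h₁, h₂, h₃, h₄, h₅, h₆, h₇, h₈, h₉⟩
    refine ⟨h₁, h₂, h₃, h₄, h₅, h₆, h₇, h₈, fun ψ hψ => ?_⟩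
    simpa only [key ψ hψ] using h₉ ψ hψ
  · rintro ⟨h₁, h₂, h₃, h₄, h₅, h₆, h₇, h₈, h₉⟩
    refine ⟨h₁, h₂, h₃, h₄, h₅, h₆, h₇, h₈, fun ψ hψ => ?_⟩
    simpa only [key ψ hψ] using h₉ ψ hψ

/-- The global notion at each finite horizon. [cite: DiPernaLions1989, §II.1 (12)–(14)] -/
theorem IsWeakScalarTransportDiagForced.on (h : IsWeakScalarTransportDiagForced a κ u s θ₀ θ) (hT : 0 < T) :
    IsWeakScalarTransportDiagForcedOn T a κ u s θ₀ θ :=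
  h T hT

/-- The global notion with `s = 0` is the global homogeneous diagonal notion horizon by horizon.
[cite: DiPernaLions1989, §II.1 (12)–(14)] -/
theorem isWeakScalarTransportDiagForced_zero_iff :
    IsWeakScalarTransportDiagForced a κ u 0 θ₀ θ ↔ ∀ T : ℝ, 0 < T → IsWeakScalarTransportDiagOn T a κ u θ₀ θ := by
  simp only [IsWeakScalarTransportDiagForced, isWeakScalarTransportDiagForcedOn_zero_iff]

end Torus

end Literature.Analysis.FluidPDE

end
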